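import Summits.MatrixMultiplication.OmegaCensus.SmallFormats.MatMul22nRankGF5ThreeNPlusThreeCore
import Summits.MatrixMultiplication.OmegaCensus.SmallFormats.MatMul22nRankGF5XCapCertData0
import Summits.MatrixMultiplication.OmegaCensus.SmallFormats.MatMul22nRankGF5XCapCertData1
import Summits.MatrixMultiplication.OmegaCensus.SmallFormats.MatMul22nRankGF5XCapCertData2
import Summits.MatrixMultiplication.OmegaCensus.SmallFormats.MatMul22nRankGF5XCapCertData3
import Summits.MatrixMultiplication.OmegaCensus.SmallFormats.MatMul22nRankGF5XCapCertData4
import Summits.MatrixMultiplication.OmegaCensus.SmallFormats.MatMul22nRankGF5XCapCertData5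
import Summits.MatrixMultiplication.OmegaCensus.SmallFormats.MatMul22nRankGF5XCapCertData6
import Summits.MatrixMultiplication.OmegaCensus.SmallFormats.MatMul22nRankGF5XCapCertData7
import Summits.MatrixMultiplication.OmegaCensus.SmallFormats.MatMul22nRankGF5XCapCertData8
import Summits.MatrixMultiplication.OmegaCensus.SmallFormats.MatMul22nRankGF5XCapCertData9
import Summits.MatrixMultiplication.OmegaCensus.SmallFormats.MatMul22nRankGF5XCapCertData10
import Summits.MatrixMultiplication.OmegaCensus.SmallFormats.MatMul22nRankGF5XCapCertData11
import Summits.MatrixMultiplication.OmegaCensus.SmallFormats.MatMul22nRankGF5XCapCertData12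
import Summits.MatrixMultiplication.OmegaCensus.SmallFormats.MatMul22nRankGF5XCapCertData13
import HarnessLib

/-!
# ω-census family (a): the assembled branch-and-bound certificate for the slack-2 X-cap system over `𝔽₅`

Framing (verbatim): lottery ticket; floor = certified bounds/negative ranges. HONEST FRAMING: assembly of machine-checked data;
the consequence for `R_𝔽₅(⟨2,2,n⟩)` is drawn in the theorem file. Nothing here is progress on `ω`.
-/

namespace Summit.MatrixMultiplication.OmegaCensus.SmallFormats

/-- The full certificate (top skeleton over the subtrees). -/
def xcapCert5 : BoxCert.Cert :=
  (BoxCert.Cert.branch 9 1 (BoxCert.Cert.branch 38 0 xcapCert5_0 (BoxCert.Cert.branch 14 0 xcapCert5_1 (BoxCert.Cert.branch 53 0 xcapCert5_2 xcapCert5_3))) (BoxCert.Cert.branch 15 0 (BoxCert.Cert.branch 65 0 xcapCert5_4 (BoxCert.Cert.branch 133 0 xcapCert5_5 (BoxCert.Cert.branch 23 0 xcapCert5_6 (BoxCert.Cert.branch 45 0 xcapCert5_7 (BoxCert.Cert.branch 44 0 xcapCert5_8 (BoxCert.Cert.branch 59 0 xcapCert5_9 xcapCert5_10)))))) (BoxCert.Cert.branch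 38 0 (BoxCert.Cert.branch 122 0 xcapCert5_11 (BoxCert.Cert.branch 134 0 xcapCert5_12 xcapCert5_13)) (BoxCert.Cert.branch 75 0 (BoxCert.Cert.branch 33 0 (BoxCert.Cert.branch 84 0 xcapCert5_14 (BoxCert.Cert.branch 64 0 xcapCert5_15 xcapCert5_16)) xcapCert5_17) (BoxCert.Cert.branch 138 0 xcapCert5_18 (BoxCert.Cert.branch 58 0 (BoxCert.Cert.branch 54 0 xcapCert5_19 xcapCert5_20) (BoxCert.Cert.branch 71 0 xcapCert5_21 (BoxCert.Cert.branch 94 0 (BoxCert.Cert.branch 48 0 xcapCert5_22 xcapCert5_23) (BoxCert.Cert.branch 49 0 (BoxCert.Cert.branch 11 0 xcapCert5_24 (BoxCert.Cert.branch 24 0 xcapCert5_25 xcapCert5_26)) (BoxCert.Cert.branch 55 0 (BoxCert.Cert.branch 76 0 xcapCert5_27 xcapCert5_28) (BoxCert.Cert.branch 143 0 xcapCert5_29 (BoxCert.Cert.branch 103 0 xcapCert5_30 (BoxCert.Cert.branch 85 0 xcapCert5_31 (BoxCert.Cert.branch 83 0 xcapCert5_32 xcapCert5_33))))))))))))))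

/-- **The certificate passes at the root box `[0,2]^157`.** -/
theorem xcapCert5_ok : xcapCert5.check xcapSys5 840 53 2 [] = true :=
  (BoxCert.check_branch xcapSys5 (by decide) (by decide) (BoxCert.check_branch xcapSys5 (by decide) (by decide) xcapCert5_0_ok (BoxCert.check_branch xcapSys5 (by decide) (by decide) xcapCert5_1_ok (BoxCert.check_branch xcapSys5 (by decide) (by decide) xcapCert5_2_ok xcapCert5_3_ok))) (BoxCert.check_branch xcapSys5 (by decide) (by decide) (BoxCert.check_branch xcapSys5 (by decide) (by decide) xcapCert5_4_ok (BoxCert.check_branch xcapSys5 (by decide) (by decide) xcapCert5_5_ok (BoxCert.check_branch xcapSys5 (by decide) (by decide) xcapCert5_6_ok (BoxCert.check_branch xcapSys5 (by decide) (by decide) xcapCert5_7_ok (BoxCert.check_branch xcapSys5 (by decide) (by decide) xcapCert5_8_ok (BoxCert.check_branch xcapSys5 (by decide) (by decide) xcapCert5_9_ok xcapCert5_10_ok)))))) (BoxCert.check_branch xcapSys5 (by decide) (by decide) (BoxCert.check_branch xcapSys5 (by decide) (by decide) xcapCert5_11_ok (BoxCert.check_branch xcapSys5 (by decide) (by decide)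 xcapCert5_12_ok xcapCert5_13_ok)) (BoxCert.check_branch xcapSys5 (by decide) (by decide) (BoxCert.check_branch xcapSys5 (by decide) (by decide) (BoxCert.check_branch xcapSys5 (by decide) (by decide) xcapCert5_14_ok (BoxCert.check_branch xcapSys5 (by decide) (by decide) xcapCert5_15_ok xcapCert5_16_ok)) xcapCert5_17_ok) (BoxCert.check_branch xcapSys5 (by decide) (by decide) xcapCert5_18_ok (BoxCert.check_branch xcapSys5 (by decide) (by decide) (BoxCert.check_branch xcapSys5 (by decide) (by decide) xcapCert5_19_ok xcapCert5_20_ok) (BoxCert.check_branch xcapSys5 (by decide) (by decide) xcapCert5_21_ok (BoxCert.check_branch xcapSys5 (by decide) (by decide) (BoxCert.check_branch xcapSys5 (by decide) (by decide) xcapCert5_22_ok xcapCert5_23_ok) (BoxCert.check_branch xcapSys5 (by decide) (by decide) (BoxCert.check_branch xcapSys5 (by decide) (by decide) xcapCert5_24_ok (BoxCert.check_branch xcapSys5 (by decide) (by decide) xcapCert5_25_ok xcapCert5_26_ok)) (BoxCert.check_branch xcapSys5 (by decide) (by decide) (BoxCert.check_branch xcapSys5 (by decide) (by decide) xcapCert5_27_ok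 xcapCert5_28_ok) (BoxCert.check_branch xcapSys5 (by decide) (by decide) xcapCert5_29_ok (BoxCert.check_branch xcapSys5 (by decide) (by decide) xcapCert5_30_ok (BoxCert.check_branch xcapSys5 (by decide) (by decide) xcapCert5_31_ok (BoxCert.check_branch xcapSys5 (by decide) (by decide) xcapCert5_32_ok xcapCert5_33_ok))))))))))))))

end Summit.MatrixMultiplication.OmegaCensus.SmallFormats
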